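import Literature.NumberTheory.ModularForms.InterpolationKernels
import HarnessLib

/-!
# Residues of the interpolation kernels (CKMRV Theorem 4.1 (3)), dimension `8`, `+`

Cohn–Kumar–Miller–Radchenko–Viazovska, Ann. of Math. 196 (2022) = arXiv:1902.05438, Theorem 4.1 (3):
"For `z ∈ ℍ` and `r ∈ R`, the residues of `𝒦` and `𝒦±` as functions of `τ` satisfy
`Res_{τ=z}(𝒦±|^τ_{d/2} r) = −φ±(r)/2π`, where … `φ±(I) = 0`, `φ±(T) = 1`, `φ±(TS) = 0`."
§4.4: "We can calculate residues by using the identity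
`lim_{τ→z} f(τ)(τ−z)/(j(τ)−j(z)) = f(z)/j′(z) = i f(z)Δ(z)/(2πE₁₄(z))` … We find that
`Res_{τ=z} Υ₊^{(d)} = (π/72) [[0,0,1],[0,−2,0],[1,0,0]]`."

We formalise the residue of `g : ℍ → ℂ` at `z` as the limit of `(w − z)·g(w)` along the punctured
neighbourhood of `z` in `ℂ` (`HasKernelResidue g z r`), prove the limit identity above from
`j′ = −2πi E₄²E₆/Δ` (`ModularFormsRamanujan.lean`) at the points where `j′(z) ≠ 0`
(`hasKernelResidue_div_kleinJ_sub`), and PROVE Theorem 4.1 (3) for `𝒦₊^{(8)}` and the words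
`r = I, T, TS` at such `z`: the residues of `τ ↦ 𝒦₊^{(8)}(τ,z)`, `(𝒦₊^{(8)}|₄T)(τ,z)`,
`(𝒦₊^{(8)}|₄TS)(τ,z)` at `τ = z` are `0`, `−1/(2π)`, `0`
(`hasKernelResidue_kernelPlus8`, `…_slash_T`, `…_slash_TS`). The words `S·r` follow from
`𝒦₊|₄(S + I) = 0` (`isAnnPlus_kernelPlus8`). The elliptic points `j′(z) = 0` (orbits of `i`, `ρ`),
where the simplicity of the poles needs the finer analysis of §4.4, are excluded here.

## References

* H. Cohn, A. Kumar, S. D. Miller, D. Radchenko, M. Viazovska, Ann. of Math. 196 (2022),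
  arXiv:1902.05438, Theorem 4.1 (3); §4.4 (residue computation). [CohnEtAl2019]
-/

noncomputable section

open Complex hiding I
open Filter Topology ModularForm SlashInvariantForm EisensteinSeries
open UpperHalfPlane hiding I
open Complex (I)
open scoped Real MatrixGroups ModularForm Manifold

namespace Literature.NumberTheory.ModularForms

open Literature.NumberTheory.EllipticCurves.ModularForms (kleinJ kleinJ_smul mdifferentiable_kleinJ
  continuous_kleinJ deriv_kleinJ_comp_ofComplex)

/-! ## Residues as punctured limits -/

/-- `g : ℍ → ℂ` has residue `r` at `z` (in the sense of a simple pole or a removable singularity):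
`(w − z)·g(w) → r` as `w → z`, `w ≠ z` (through `ofComplex`). [folklore] -/
def HasKernelResidue (g : ℍ → ℂ) (z : ℍ) (r : ℂ) : Prop :=
  Tendsto (fun w : ℂ => (w - z) * g (ofComplex w)) (𝓝[≠] (z : ℂ)) (𝓝 r)

/-- The slope of `j` at `z`: `(j(w) − j(z))/(w − z) → j′(z)`. [folklore] -/
theorem tendsto_slope_kleinJ (z : ℍ) :
    Tendsto (fun w : ℂ => (kleinJ (ofComplex w) - kleinJ z) / (w - z)) (𝓝[≠] (z : ℂ))
      (𝓝 (deriv (kleinJ ∘ ofComplex) z)) := by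
  have h : HasDerivAt (kleinJ ∘ ofComplex) (deriv (kleinJ ∘ ofComplex) z) z :=
    (UpperHalfPlane.mdifferentiableAt_iff.mp (mdifferentiable_kleinJ z)).hasDerivAt
  rw [hasDerivAt_iff_tendsto_slope] at h
  refine h.congr fun w => ?_
  rw [slope_def_field, Function.comp_apply, Function.comp_apply, ofComplex_apply]

/-- A function on `ℍ` continuous at `z` tends to its value along the punctured neighbourhood
(through `ofComplex`). [folklore] -/
theorem tendsto_ofComplex_punctured {A : ℍ → ℂ} {z : ℍ} (hA : ContinuousAt A z) :
    Tendsto (fun w : ℂ => A (ofComplex w)) (𝓝[≠] (z : ℂ)) (𝓝 (A z)) := by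
  have h1 : ContinuousAt (A ∘ ofComplex) (z : ℂ) := by
    have hc : ContinuousAt ofComplex (z : ℂ) :=
      (continuousOn_ofComplex (z : ℂ) z.im_pos).continuousAt (isOpen_upperHalfPlaneSet.mem_nhds z.im_pos)
    rw [← ofComplex_apply z] at hA
    exact ContinuousAt.comp hA hc
  have := h1.tendsto
  rw [Function.comp_apply, ofComplex_apply] at this
  exact this.mono_left nhdsWithin_le_nhds

/-- **`lim_{τ→z} (τ − z)·(A(τ)/(j(τ) − j(z)) + B(τ)) = A(z)/j′(z)`** for `A`, `B` continuous at `z`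
and `j′(z) ≠ 0` (CKMRV §4.4). [cite: CohnEtAl2019, §4.4] -/
theorem hasKernelResidue_div_kleinJ_sub {A B : ℍ → ℂ} {z : ℍ} (hA : ContinuousAt A z)
    (hB : ContinuousAt B z) (hj : deriv (kleinJ ∘ ofComplex) z ≠ 0) :
    HasKernelResidue (fun τ => A τ / (kleinJ τ - kleinJ z) + B τ) z (A z / deriv (kleinJ ∘ ofComplex) z) := by
  unfold HasKernelResidue
  have hslope := tendsto_slope_kleinJ z
  have hA' := tendsto_ofComplex_punctured hA
  have hB' := tendsto_ofComplex_punctured hB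
  -- `(w − z)·B → 0`
  have hwz : Tendsto (fun w : ℂ => w - z) (𝓝[≠] (z : ℂ)) (𝓝 0) := by
    have : Tendsto (fun w : ℂ => w - z) (𝓝 (z : ℂ)) (𝓝 ((z : ℂ) - z)) :=
      (continuous_id.sub continuous_const).tendsto _
    rw [sub_self] at this
    exact this.mono_left nhdsWithin_le_nhds
  have h1 : Tendsto (fun w : ℂ => A (ofComplex w) * ((kleinJ (ofComplex w) - kleinJ z) / (w - z))⁻¹ +
      (w - z) * B (ofComplex w)) (𝓝[≠] (z : ℂ)) (𝓝 (A z * (deriv (kleinJ ∘ ofComplex) z)⁻¹ + 0 * B z)) :=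
    (hA'.mul (hslope.inv₀ hj)).add (hwz.mul hB')
  rw [zero_mul, add_zero, ← div_eq_mul_inv] at h1
  refine h1.congr fun w => ?_
  rw [inv_div, mul_add, ← mul_div_assoc, mul_comm (A _), mul_div_assoc]

/-! ## Continuity of the building blocks -/

/-- `continuous_phiNeg2` (auxiliary). [folklore] -/
theorem continuous_phiNeg2 : Continuous phiNeg2 := continuous_coe
/-- `φ₀` is continuous. [folklore] -/
theorem continuous_phi0 : Continuous phi0 := isClassP_phi0.1.continuous
/-- `φ₂` is continuous. [folklore] -/
theorem continuous_phi2 : Continuous phi2 := isClassP_phi2.1.continuous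
/-- `E₂` is continuous. [folklore] -/
theorem continuous_E2' : Continuous E2 := E2_mdifferentiable.continuous

/-- The `SL₂(ℤ)`-action on `ℍ` is continuous. [folklore] -/
theorem continuous_sl2z_smul (γ : SL(2, ℤ)) : Continuous fun τ : ℍ => γ • τ :=
  continuous_const_smul ((γ : GL (Fin 2) ℝ))

/-- Slashing a continuous function gives a continuous function. [folklore] -/
theorem continuous_sl_slash {f : ℍ → ℂ} (hf : Continuous f) (k : ℤ) (γ : SL(2, ℤ)) :
    Continuous (f ∣[k] γ) := by
  have h : f ∣[k] γ = fun τ => f (γ • τ) * denom (γ : GL (Fin 2) ℝ) τ ^ (-k) := by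
    funext τ; rw [SL_slash_apply]
  rw [h]
  refine (hf.comp (continuous_sl2z_smul γ)).mul (Continuous.zpow₀ ?_ _ fun τ => Or.inl (denom_ne_zero _ τ))
  rw [show (fun τ : ℍ => denom (γ : GL (Fin 2) ℝ) τ) = fun τ : ℍ => ((γ 1 0 : ℤ) : ℂ) * τ + ((γ 1 1 : ℤ) : ℂ) by
    funext τ; rw [ModularGroup.denom_apply]]
  fun_prop

/-- Eventually near `z` (punctured), `j(w) ≠ j(z)` if `j′(z) ≠ 0`. [folklore] -/
theorem eventually_kleinJ_sub_ne_zero {z : ℍ} (hj : deriv (kleinJ ∘ ofComplex) z ≠ 0) :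
    ∀ᶠ w in 𝓝[≠] (z : ℂ), kleinJ (ofComplex w) - kleinJ z ≠ 0 := by
  have h1 := (tendsto_slope_kleinJ z).eventually_ne hj
  filter_upwards [h1, self_mem_nhdsWithin] with w hw hwz
  intro h0
  apply hw
  rw [h0, zero_div]

/-- Residues are invariant under eventual equality. [folklore] -/
theorem HasKernelResidue.congr' {g₁ g₂ : ℍ → ℂ} {z : ℍ} {r : ℂ} (h : HasKernelResidue g₁ z r)
    (heq : ∀ᶠ w in 𝓝[≠] (z : ℂ), g₁ (ofComplex w) = g₂ (ofComplex w)) : HasKernelResidue g₂ z r := by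
  unfold HasKernelResidue at h ⊢
  refine h.congr' ?_
  filter_upwards [heq] with w hw
  rw [hw]

/-! ## The residue of `𝒦₊^{(8)}|₄γ` for a general `γ ∈ SL₂(ℤ)` -/

/-- The pole coefficients `Aᵢ(z)` of the three columns at `τ = z`:
`A₁ = cE₆E₈φ̃₂/Δ`, `A₂ = −2cE₄E₁₀φ̃₀/Δ`, `A₃ = c(E₁₄/Δ)φ̃₋₂` (`c = π²/(36i)`), i.e. the vector
`(cE₁₄/Δ)·(φ̃₂, −2φ̃₀, φ̃₋₂)(z)`. [cite: CohnEtAl2019, §4.4] -/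
def resVecPlus8 (z : ℍ) : Fin 3 → ℂ :=
  ![(π : ℂ) ^ 2 / (36 * I) / ModularForm.discriminant z * (E₆ z * E8fun z * phiTilde2 z),
    (π : ℂ) ^ 2 / (36 * I) / ModularForm.discriminant z * (-2 * E₄ z * E10fun z * phiTilde0 z),
    (π : ℂ) ^ 2 / (36 * I) / ModularForm.discriminant z * (E14fun z * phiTildeNeg2 z)]

/-- **Residue of `𝒦₊^{(8)}|₄γ` at `τ = z`** (`j′(z) ≠ 0`):
`Res = [(φ₋₂|₋₂γ)(z)A₁ + (φ₀|₀γ)(z)A₂ + (φ₂|₂γ)(z)A₃]/j′(z)`. [cite: CohnEtAl2019, §4.4] -/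
theorem hasKernelResidue_kernelPlus8_slash (z : ℍ) (γ : SL(2, ℤ))
    (hj : deriv (kleinJ ∘ ofComplex) z ≠ 0) :
    HasKernelResidue ((fun τ => kernelPlus8 τ z) ∣[(4 : ℤ)] γ) z
      (((phiNeg2 ∣[(-2 : ℤ)] γ) z * resVecPlus8 z 0 + (phi0 ∣[(0 : ℤ)] γ) z * resVecPlus8 z 1 +
        (phi2 ∣[(2 : ℤ)] γ) z * resVecPlus8 z 2) / deriv (kleinJ ∘ ofComplex) z) := by
  set c : ℂ := (π : ℂ) ^ 2 / (36 * I) with hc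
  -- the `τ`-coefficients of the decomposition `𝒦 = φ₋₂a₁ + φ₀a₂ + φ₂a₃` (as in `isAnnPlus_kernelPlus8`)
  set a₁ : ℍ → ℂ := ⇑E₆ * fun τ => c / (ModularForm.discriminant z * (kleinJ τ - kleinJ z)) *
    ((kleinJ τ - kleinJ z) * ModularForm.discriminant z * phiTildeNeg2 z + E8fun z * phiTilde2 z) with ha₁
  set a₂ : ℍ → ℂ := ⇑E₄ * fun τ => c / (ModularForm.discriminant z * (kleinJ τ - kleinJ z)) *
    (-2 * (kleinJ τ - kleinJ z) * ModularForm.discriminant z * phiTildeNeg2 z -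
      2 * E10fun z * phiTilde0 z) with ha₂
  set a₃ : ℍ → ℂ := f2fun * fun τ => c / (ModularForm.discriminant z * (kleinJ τ - kleinJ z)) *
    (ModularForm.discriminant z * phiTildeNeg2 z) with ha₃
  have h₁ : IsLevelOneInvariant (4 + 2) a₁ :=
    (isLevelOneInvariant_E₆.mul (isLevelOneInvariant_comp_kleinJ fun j =>
      c / (ModularForm.discriminant z * (j - kleinJ z)) *
        ((j - kleinJ z) * ModularForm.discriminant z * phiTildeNeg2 z + E8fun z * phiTilde2 z))).cast
      (by norm_num)
  have h₂ : IsLevelOneInvariant 4 a₂ :=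
    (isLevelOneInvariant_E₄.mul (isLevelOneInvariant_comp_kleinJ fun j =>
      c / (ModularForm.discriminant z * (j - kleinJ z)) *
        (-2 * (j - kleinJ z) * ModularForm.discriminant z * phiTildeNeg2 z -
          2 * E10fun z * phiTilde0 z))).cast (by norm_num)
  have h₃ : IsLevelOneInvariant (4 - 2) a₃ :=
    (isLevelOneInvariant_f2.mul (isLevelOneInvariant_comp_kleinJ fun j =>
      c / (ModularForm.discriminant z * (j - kleinJ z)) *
        (ModularForm.discriminant z * phiTildeNeg2 z))).cast (by norm_num)
  have key : (fun τ => kernelPlus8 τ z) = phiNeg2 * a₁ + phi0 * a₂ + phi2 * a₃ := by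
    funext τ
    simp only [kernelPlus8, ha₁, ha₂, ha₃, hc, Pi.add_apply, Pi.mul_apply]
    ring
  -- slashing: `(𝒦|₄γ) = (φ₋₂|₋₂γ)a₁ + (φ₀|₀γ)a₂ + (φ₂|₂γ)a₃`
  have hslash : (fun τ => kernelPlus8 τ z) ∣[(4 : ℤ)] γ =
      phiNeg2 ∣[(-2 : ℤ)] γ * a₁ + phi0 ∣[(0 : ℤ)] γ * a₂ + phi2 ∣[(2 : ℤ)] γ * a₃ := by
    rw [key, SlashAction.add_slash, SlashAction.add_slash, show (4 : ℤ) = -2 + (4 + 2) by norm_num,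
      mul_slash_SL2, h₁ γ, show (-2 : ℤ) + (4 + 2) = 0 + 4 by norm_num, mul_slash_SL2, h₂ γ,
      show (0 : ℤ) + 4 = 2 + (4 - 2) by norm_num, mul_slash_SL2, h₃ γ]
  -- the shape `A/J + B` eventually
  set A : ℍ → ℂ := fun τ => (phiNeg2 ∣[(-2 : ℤ)] γ) τ * (c / ModularForm.discriminant z * (E₆ τ * E8fun z * phiTilde2 z)) +
    (phi0 ∣[(0 : ℤ)] γ) τ * (c / ModularForm.discriminant z * (-2 * E₄ τ * E10fun z * phiTilde0 z)) +
    (phi2 ∣[(2 : ℤ)] γ) τ * (c / ModularForm.discriminant z * (f2fun τ * ModularForm.discriminant z * phiTildeNeg2 z))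
    with hA
  set B : ℍ → ℂ := fun τ => (phiNeg2 ∣[(-2 : ℤ)] γ) τ * (c * E₆ τ * phiTildeNeg2 z) +
    (phi0 ∣[(0 : ℤ)] γ) τ * (c * (-2) * E₄ τ * phiTildeNeg2 z) with hB
  have hcontφ : Continuous (phiNeg2 ∣[(-2 : ℤ)] γ) ∧ Continuous (phi0 ∣[(0 : ℤ)] γ) ∧
      Continuous (phi2 ∣[(2 : ℤ)] γ) :=
    ⟨continuous_sl_slash continuous_phiNeg2 _ _, continuous_sl_slash continuous_phi0 _ _,
      continuous_sl_slash continuous_phi2 _ _⟩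
  have hE4 : Continuous (⇑E₄ : ℍ → ℂ) := E₄.holo'.continuous
  have hE6 : Continuous (⇑E₆ : ℍ → ℂ) := E₆.holo'.continuous
  have hΔc : Continuous (ModularForm.discriminant : ℍ → ℂ) := CuspForm.discriminant.holo'.continuous
  have hf2 : Continuous f2fun := by
    have : f2fun = fun τ => E₄ τ * E₄ τ * E₆ τ / ModularForm.discriminant τ := by
      funext τ; simp [f2fun, E14fun, div_eq_mul_inv]
    rw [this]
    exact ((hE4.mul hE4).mul hE6).div hΔc fun τ => ModularForm.discriminant_ne_zero τ
  have hAc : Continuous A := by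
    rw [hA]
    refine ((hcontφ.1.mul (continuous_const.mul ((hE6.mul continuous_const).mul continuous_const))).add
      (hcontφ.2.1.mul (continuous_const.mul (((continuous_const.mul hE4).mul continuous_const).mul
        continuous_const)))).add
      (hcontφ.2.2.mul (continuous_const.mul ((hf2.mul continuous_const).mul continuous_const)))
  have hBc : Continuous B := by
    rw [hB]
    exact (hcontφ.1.mul ((continuous_const.mul hE6).mul continuous_const)).add
      (hcontφ.2.1.mul (((continuous_const.mul continuous_const).mul hE4).mul continuous_const))
  have hres := hasKernelResidue_div_kleinJ_sub hAc.continuousAt hBc.continuousAt hj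
  -- identify the value
  have hval : A z / deriv (kleinJ ∘ ofComplex) z =
      ((phiNeg2 ∣[(-2 : ℤ)] γ) z * resVecPlus8 z 0 + (phi0 ∣[(0 : ℤ)] γ) z * resVecPlus8 z 1 +
        (phi2 ∣[(2 : ℤ)] γ) z * resVecPlus8 z 2) / deriv (kleinJ ∘ ofComplex) z := by
    congr 1
    have hΔ := ModularForm.discriminant_ne_zero z
    simp only [hA, resVecPlus8, Matrix.cons_val_zero, Matrix.cons_val_one, Matrix.head_cons,
      Matrix.cons_val_two, Matrix.tail_cons, f2fun, E14fun, Pi.mul_apply, Pi.inv_apply, hc]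
    field_simp
  rw [← hval]
  refine hres.congr' ?_
  filter_upwards [eventually_kleinJ_sub_ne_zero hj] with w hw
  have hw' := congrFun hslash (ofComplex w)
  simp only [Pi.add_apply, Pi.mul_apply] at hw'
  rw [hw']
  have hΔ := ModularForm.discriminant_ne_zero z
  simp only [ha₁, ha₂, ha₃, hA, hB, Pi.mul_apply]
  field_simp
  ring

/-! ## Theorem 4.1 (3) for `𝒦₊^{(8)}` and the words `I`, `T`, `TS` -/

/-- `E₄(z)E₆(z) ≠ 0` where `j′(z) ≠ 0`. [folklore] -/
theorem E₄_mul_E₆_ne_zero_of_deriv_kleinJ {z : ℍ} (hj : deriv (kleinJ ∘ ofComplex) z ≠ 0) :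
    E₄ z ≠ 0 ∧ E₆ z ≠ 0 :=
  (Literature.NumberTheory.EllipticCurves.ModularForms.deriv_kleinJ_ne_zero_iff z).1 hj

/-- **`Res_{τ=z} 𝒦₊^{(8)}(τ,z) = 0 = −φ₊(I)/2π`** (`j′(z) ≠ 0`). [cite: CohnEtAl2019, Theorem 4.1 (3)] -/
theorem hasKernelResidue_kernelPlus8 (z : ℍ) (hj : deriv (kleinJ ∘ ofComplex) z ≠ 0) :
    HasKernelResidue (fun τ => kernelPlus8 τ z) z 0 := by
  have h := hasKernelResidue_kernelPlus8_slash z 1 hj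
  rw [SlashAction.slash_one, SlashAction.slash_one, SlashAction.slash_one, SlashAction.slash_one] at h
  have hnum : phiNeg2 z * resVecPlus8 z 0 + phi0 z * resVecPlus8 z 1 + phi2 z * resVecPlus8 z 2 = 0 := by
    simp only [resVecPlus8, Matrix.cons_val_zero, Matrix.cons_val_one, Matrix.head_cons, Matrix.cons_val_two,
      Matrix.tail_cons, E8fun, E10fun, E14fun, Pi.mul_apply, phiNeg2, phi0, phi2, phiTildeNeg2, phiTilde0,
      phiTilde2]
    ring
  rwa [hnum, zero_div] at h

/-- **`Res_{τ=z} (𝒦₊^{(8)}|₄T)(τ,z) = −1/(2π) = −φ₊(T)/2π`** (`j′(z) ≠ 0`). [cite: CohnEtAl2019, Theorem 4.1 (3)] -/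
theorem hasKernelResidue_kernelPlus8_slash_T (z : ℍ) (hj : deriv (kleinJ ∘ ofComplex) z ≠ 0) :
    HasKernelResidue ((fun τ => kernelPlus8 τ z) ∣[(4 : ℤ)] ModularGroup.T) z (-1 / (2 * π)) := by
  have h := hasKernelResidue_kernelPlus8_slash z ModularGroup.T hj
  obtain ⟨h4, h6⟩ := E₄_mul_E₆_ne_zero_of_deriv_kleinJ hj
  have hΔ := ModularForm.discriminant_ne_zero z
  have hπ : (π : ℂ) ≠ 0 := ofReal_ne_zero.2 Real.pi_ne_zero
  have hval : ((phiNeg2 ∣[(-2 : ℤ)] ModularGroup.T) z * resVecPlus8 z 0 +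
      (phi0 ∣[(0 : ℤ)] ModularGroup.T) z * resVecPlus8 z 1 +
      (phi2 ∣[(2 : ℤ)] ModularGroup.T) z * resVecPlus8 z 2) / deriv (kleinJ ∘ ofComplex) z = -1 / (2 * π) := by
    rw [slash_T_apply, slash_T_apply, slash_T_apply, phiNeg2_vadd_one, phi0_vadd_one, phi2_vadd_one,
      deriv_kleinJ_comp_ofComplex]
    rw [div_eq_iff (by
      simp only [ne_eq, neg_mul, neg_eq_zero, mul_eq_zero, div_eq_zero_iff, pow_eq_zero_iff, OfNat.ofNat_ne_zero,
        I_ne_zero, hπ, h4, h6, hΔ, or_self, not_false_eq_true])]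
    simp only [resVecPlus8, Matrix.cons_val_zero, Matrix.cons_val_one, Matrix.head_cons, Matrix.cons_val_two,
      Matrix.tail_cons, E8fun, E10fun, E14fun, Pi.mul_apply, phiNeg2, phi0, phi2, phiTildeNeg2, phiTilde0,
      phiTilde2]
    field_simp
    ring_nf
  rwa [hval] at h

/-- **`Res_{τ=z} (𝒦₊^{(8)}|₄TS)(τ,z) = 0 = −φ₊(TS)/2π`** (`j′(z) ≠ 0`). [cite: CohnEtAl2019, Theorem 4.1 (3)] -/
theorem hasKernelResidue_kernelPlus8_slash_TS (z : ℍ) (hj : deriv (kleinJ ∘ ofComplex) z ≠ 0) :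
    HasKernelResidue ((fun τ => kernelPlus8 τ z) ∣[(4 : ℤ)] (ModularGroup.T * ModularGroup.S)) z 0 := by
  have h := hasKernelResidue_kernelPlus8_slash z (ModularGroup.T * ModularGroup.S) hj
  have hz : (z : ℂ) ≠ 0 := z.ne_zero
  have hπ : (π : ℂ) ≠ 0 := ofReal_ne_zero.2 Real.pi_ne_zero
  have hnum : (phiNeg2 ∣[(-2 : ℤ)] (ModularGroup.T * ModularGroup.S)) z * resVecPlus8 z 0 +
      (phi0 ∣[(0 : ℤ)] (ModularGroup.T * ModularGroup.S)) z * resVecPlus8 z 1 +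
      (phi2 ∣[(2 : ℤ)] (ModularGroup.T * ModularGroup.S)) z * resVecPlus8 z 2 = 0 := by
    rw [SlashAction.slash_mul, SlashAction.slash_mul, SlashAction.slash_mul, slash_S_apply', slash_S_apply',
      slash_S_apply', slash_T_apply, slash_T_apply, slash_T_apply, phiNeg2_vadd_one, phi0_vadd_one,
      phi2_vadd_one, phiNeg2_S_smul, phi0_S_smul, phi2_S_smul, E2_S_smul]
    simp only [resVecPlus8, Matrix.cons_val_zero, Matrix.cons_val_one, Matrix.head_cons, Matrix.cons_val_two,
      Matrix.tail_cons, E8fun, E10fun, E14fun, Pi.mul_apply, phiNeg2, phi0, phi2, phiTildeNeg2, phiTilde0,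
      phiTilde2, zpow_neg, zpow_ofNat, neg_neg, neg_zero]
    field_simp
    ring
  rwa [hnum, zero_div] at h

/-! ## The residue of `𝒦₋^{(8)}|₄γ` and Theorem 4.1 (3) for `𝒦₋^{(8)}` -/

/-- `continuous_psi2` (auxiliary). [folklore] -/
theorem continuous_psi2 : Continuous psi2 := mdifferentiable_psi.1.continuous
/-- `ψ₄` is continuous. [folklore] -/
theorem continuous_psi4 : Continuous psi4 := mdifferentiable_psi.2.continuous

/-- **Residue of `𝒦₋^{(8)}|₄γ` at `τ = z`** (`j′(z) ≠ 0`), with `c = (2·1728·π)⁻¹`: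
`Res = c[−2·1728·E₄E₁₀ψ̃₀ + (ψ₂|₂γ)(z)(E₁₄/Δ)(E₈ψ̃₂ − E₆ψ̃₄) + (ψ₄|₄γ)(z)((1728 − j)E₈ψ̃₂ + jE₆ψ̃₄)](z)/(Δ(z)j′(z))`.
[cite: CohnEtAl2019, §4.4] -/
theorem hasKernelResidue_kernelMinus8_slash (z : ℍ) (γ : SL(2, ℤ))
    (hj : deriv (kleinJ ∘ ofComplex) z ≠ 0) :
    HasKernelResidue ((fun τ => kernelMinus8 τ z) ∣[(4 : ℤ)] γ) z
      ((1 / (2 * 1728 * (π : ℂ)) / ModularForm.discriminant z *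
        (E₄ z * (-2 * 1728 * E10fun z * psiTilde0 z) +
          (psi2 ∣[(2 : ℤ)] γ) z * (f2fun z * (E8fun z * psiTilde2 z - E₆ z * psiTilde4 z)) +
          (psi4 ∣[(4 : ℤ)] γ) z * ((1728 - kleinJ z) * E8fun z * psiTilde2 z + kleinJ z * E₆ z * psiTilde4 z))) /
        deriv (kleinJ ∘ ofComplex) z) := by
  set c : ℂ := 1 / (2 * 1728 * (π : ℂ)) with hc
  set a₁ : ℍ → ℂ := ⇑E₄ * fun τ => c / (ModularForm.discriminant z * (kleinJ τ - kleinJ z)) *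
    (-2 * 1728 * E10fun z * psiTilde0 z) with ha₁
  set a₂ : ℍ → ℂ := f2fun * fun τ => c / (ModularForm.discriminant z * (kleinJ τ - kleinJ z)) *
    (E8fun z * psiTilde2 z - E₆ z * psiTilde4 z) with ha₂
  set a₃ : ℍ → ℂ := fun τ => c / (ModularForm.discriminant z * (kleinJ τ - kleinJ z)) *
    ((1728 - kleinJ τ) * E8fun z * psiTilde2 z + kleinJ τ * E₆ z * psiTilde4 z) with ha₃
  have h₁ : IsLevelOneInvariant 4 a₁ :=
    (isLevelOneInvariant_E₄.mul (isLevelOneInvariant_comp_kleinJ fun j =>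
      c / (ModularForm.discriminant z * (j - kleinJ z)) * (-2 * 1728 * E10fun z * psiTilde0 z))).cast
      (by norm_num)
  have h₂ : IsLevelOneInvariant (4 - 2) a₂ :=
    (isLevelOneInvariant_f2.mul (isLevelOneInvariant_comp_kleinJ fun j =>
      c / (ModularForm.discriminant z * (j - kleinJ z)) *
        (E8fun z * psiTilde2 z - E₆ z * psiTilde4 z))).cast (by norm_num)
  have h₃ : IsLevelOneInvariant (4 - 4) a₃ :=
    (isLevelOneInvariant_comp_kleinJ fun j => c / (ModularForm.discriminant z * (j - kleinJ z)) *
      ((1728 - j) * E8fun z * psiTilde2 z + j * E₆ z * psiTilde4 z)).cast (by norm_num)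
  have key : (fun τ => kernelMinus8 τ z) = a₁ + psi2 * a₂ + psi4 * a₃ := by
    funext τ
    simp only [kernelMinus8, ha₁, ha₂, ha₃, hc, Pi.add_apply, Pi.mul_apply]
    ring
  have hslash : (fun τ => kernelMinus8 τ z) ∣[(4 : ℤ)] γ = a₁ + psi2 ∣[(2 : ℤ)] γ * a₂ + psi4 ∣[(4 : ℤ)] γ * a₃ := by
    rw [key, SlashAction.add_slash, SlashAction.add_slash, h₁ γ, show (4 : ℤ) = 2 + (4 - 2) by norm_num,
      mul_slash_SL2, h₂ γ, show (2 : ℤ) + (4 - 2) = 4 + (4 - 4) by norm_num, mul_slash_SL2, h₃ γ,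
      show (4 : ℤ) + (4 - 4) = 4 by norm_num]
  set A : ℍ → ℂ := fun τ => c / ModularForm.discriminant z *
    (E₄ τ * (-2 * 1728 * E10fun z * psiTilde0 z) +
      (psi2 ∣[(2 : ℤ)] γ) τ * (f2fun τ * (E8fun z * psiTilde2 z - E₆ z * psiTilde4 z)) +
      (psi4 ∣[(4 : ℤ)] γ) τ * ((1728 - kleinJ τ) * E8fun z * psiTilde2 z + kleinJ τ * E₆ z * psiTilde4 z))
    with hA
  have hE4 : Continuous (⇑E₄ : ℍ → ℂ) := E₄.holo'.continuous
  have hE6 : Continuous (⇑E₆ : ℍ → ℂ) := E₆.holo'.continuous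
  have hΔc : Continuous (ModularForm.discriminant : ℍ → ℂ) := CuspForm.discriminant.holo'.continuous
  have hf2 : Continuous f2fun := by
    have : f2fun = fun τ => E₄ τ * E₄ τ * E₆ τ / ModularForm.discriminant τ := by
      funext τ; simp [f2fun, E14fun, div_eq_mul_inv]
    rw [this]
    exact ((hE4.mul hE4).mul hE6).div hΔc fun τ => ModularForm.discriminant_ne_zero τ
  have hψ2 : Continuous (psi2 ∣[(2 : ℤ)] γ) := continuous_sl_slash continuous_psi2 _ _
  have hψ4 : Continuous (psi4 ∣[(4 : ℤ)] γ) := continuous_sl_slash continuous_psi4 _ _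
  have hAc : Continuous A := by
    rw [hA]
    refine continuous_const.mul (((hE4.mul continuous_const).add (hψ2.mul (hf2.mul continuous_const))).add
      (hψ4.mul ((((continuous_const.sub continuous_kleinJ).mul continuous_const).mul continuous_const).add
        ((continuous_kleinJ.mul continuous_const).mul continuous_const))))
  have hres := hasKernelResidue_div_kleinJ_sub (B := fun _ => 0) hAc.continuousAt continuousAt_const hj
  have hval : A z = c / ModularForm.discriminant z *
      (E₄ z * (-2 * 1728 * E10fun z * psiTilde0 z) +
        (psi2 ∣[(2 : ℤ)] γ) z * (f2fun z * (E8fun z * psiTilde2 z - E₆ z * psiTilde4 z)) +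
        (psi4 ∣[(4 : ℤ)] γ) z * ((1728 - kleinJ z) * E8fun z * psiTilde2 z + kleinJ z * E₆ z * psiTilde4 z)) := rfl
  rw [hval] at hres
  refine hres.congr' ?_
  filter_upwards [eventually_kleinJ_sub_ne_zero hj] with w hw
  have hw' := congrFun hslash (ofComplex w)
  simp only [Pi.add_apply, Pi.mul_apply] at hw'
  rw [hw', add_zero]
  have hΔ := ModularForm.discriminant_ne_zero z
  simp only [ha₁, ha₂, ha₃, hA, Pi.mul_apply]
  field_simp

/-- **`Res_{τ=z} 𝒦₋^{(8)}(τ,z) = 0 = −φ₋(I)/2π`** (`j′(z) ≠ 0`). The transcendental factors `𝓛(z)`,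
`𝓛_S(z)` drop out through the identities `ξ₂A₂ + ξ₄A₃ = E₁₄/(πΔ)`, `(ξ₂|S)A₂ + (ξ₄|S)A₃ = 0`
(polynomial identities in `V, W` via `U = V + W`, `E₄ = ½(U²+V²+W²)`, `E₆ = ½(U+V)(U+W)(W−V)`,
`Δ = (UVW)²/256`). [cite: CohnEtAl2019, Theorem 4.1 (3)] -/
theorem hasKernelResidue_kernelMinus8 (z : ℍ) (hj : deriv (kleinJ ∘ ofComplex) z ≠ 0) :
    HasKernelResidue (fun τ => kernelMinus8 τ z) z 0 := by
  have h := hasKernelResidue_kernelMinus8_slash z 1 hj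
  rw [SlashAction.slash_one, SlashAction.slash_one, SlashAction.slash_one] at h
  have hΔ := ModularForm.discriminant_ne_zero z
  have hπ : (π : ℂ) ≠ 0 := ofReal_ne_zero.2 Real.pi_ne_zero
  have hV := thetaV_ne_zero z
  have hW := thetaW_ne_zero z
  have hnum : 1 / (2 * 1728 * (π : ℂ)) / ModularForm.discriminant z *
      (E₄ z * (-2 * 1728 * E10fun z * psiTilde0 z) +
        psi2 z * (f2fun z * (E8fun z * psiTilde2 z - E₆ z * psiTilde4 z)) +
        psi4 z * ((1728 - kleinJ z) * E8fun z * psiTilde2 z + kleinJ z * E₆ z * psiTilde4 z)) = 0 := by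
    have hU := thetaU_ne_zero z
    simp only [E8fun, E10fun, E14fun, f2fun, kleinJ, psi2, psi4, xi2, xi2S, xi4, xi4S, psiTilde0, psiTilde2,
      psiTilde4, Pi.mul_apply, Pi.add_apply, Pi.sub_apply, Pi.neg_apply, Pi.smul_apply, Pi.inv_apply,
      smul_eq_mul, E₄_eq_theta, E₆_eq_theta, discriminant_eq_theta]
    field_simp
    simp only [thetaU_apply_eq]
    ring
  rwa [hnum, zero_div] at h

/-- **`Res_{τ=z} (𝒦₋^{(8)}|₄T)(τ,z) = −1/(2π) = −φ₋(T)/2π`** (`j′(z) ≠ 0`; `ψ|T = ψ + iπξ`).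
[cite: CohnEtAl2019, Theorem 4.1 (3)] -/
theorem hasKernelResidue_kernelMinus8_slash_T (z : ℍ) (hj : deriv (kleinJ ∘ ofComplex) z ≠ 0) :
    HasKernelResidue ((fun τ => kernelMinus8 τ z) ∣[(4 : ℤ)] ModularGroup.T) z (-1 / (2 * π)) := by
  have h := hasKernelResidue_kernelMinus8_slash z ModularGroup.T hj
  rw [psi2_slash_T, psi4_slash_T] at h
  obtain ⟨h4, h6⟩ := E₄_mul_E₆_ne_zero_of_deriv_kleinJ hj
  have hΔ := ModularForm.discriminant_ne_zero z
  have hπ : (π : ℂ) ≠ 0 := ofReal_ne_zero.2 Real.pi_ne_zero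
  have hU := thetaU_ne_zero z
  have hV := thetaV_ne_zero z
  have hW := thetaW_ne_zero z
  have hval : 1 / (2 * 1728 * (π : ℂ)) / ModularForm.discriminant z *
      (E₄ z * (-2 * 1728 * E10fun z * psiTilde0 z) +
        (psi2 + (↑π * I) • xi2) z * (f2fun z * (E8fun z * psiTilde2 z - E₆ z * psiTilde4 z)) +
        (psi4 + (↑π * I) • xi4) z * ((1728 - kleinJ z) * E8fun z * psiTilde2 z + kleinJ z * E₆ z * psiTilde4 z)) /
      deriv (kleinJ ∘ ofComplex) z = -1 / (2 * π) := by
    rw [deriv_kleinJ_comp_ofComplex, div_eq_iff (by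
      simp only [ne_eq, neg_mul, neg_eq_zero, mul_eq_zero, div_eq_zero_iff, pow_eq_zero_iff, OfNat.ofNat_ne_zero,
        I_ne_zero, hπ, h4, h6, hΔ, or_self, not_false_eq_true])]
    -- rewrite `E₄, E₆` (outside the theta expressions) is unnecessary: everything in thetas
    simp only [E8fun, E10fun, E14fun, f2fun, kleinJ, psi2, psi4, xi2, xi2S, xi4, xi4S, psiTilde0, psiTilde2,
      psiTilde4, Pi.mul_apply, Pi.add_apply, Pi.sub_apply, Pi.neg_apply, Pi.smul_apply, Pi.inv_apply,
      smul_eq_mul, E₄_eq_theta, E₆_eq_theta, discriminant_eq_theta] at h4 h6 ⊢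
    field_simp
    simp only [thetaU_apply_eq]
    ring
  rwa [hval] at h

/-- **`Res_{τ=z} (𝒦₋^{(8)}|₄TS)(τ,z) = 0 = −φ₋(TS)/2π`** (`j′(z) ≠ 0`; `ψ|TS = ψ + iπ(ξ|S)`).
[cite: CohnEtAl2019, Theorem 4.1 (3)] -/
theorem hasKernelResidue_kernelMinus8_slash_TS (z : ℍ) (hj : deriv (kleinJ ∘ ofComplex) z ≠ 0) :
    HasKernelResidue ((fun τ => kernelMinus8 τ z) ∣[(4 : ℤ)] (ModularGroup.T * ModularGroup.S)) z 0 := by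
  have h := hasKernelResidue_kernelMinus8_slash z (ModularGroup.T * ModularGroup.S) hj
  rw [SlashAction.slash_mul]
  simp only [SlashAction.slash_mul, psi2_slash_T, psi4_slash_T, SlashAction.add_slash, SL_smul_slash,
    psi2_slash_S, psi4_slash_S, xi2_slash_S, xi4_slash_S] at h
  have hΔ := ModularForm.discriminant_ne_zero z
  have hπ : (π : ℂ) ≠ 0 := ofReal_ne_zero.2 Real.pi_ne_zero
  have hU := thetaU_ne_zero z
  have hV := thetaV_ne_zero z
  have hW := thetaW_ne_zero z
  have hnum : 1 / (2 * 1728 * (π : ℂ)) / ModularForm.discriminant z *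
      (E₄ z * (-2 * 1728 * E10fun z * psiTilde0 z) +
        (psi2 + (↑π * I) • xi2S) z * (f2fun z * (E8fun z * psiTilde2 z - E₆ z * psiTilde4 z)) +
        (psi4 + (↑π * I) • xi4S) z * ((1728 - kleinJ z) * E8fun z * psiTilde2 z + kleinJ z * E₆ z * psiTilde4 z)) = 0 := by
    simp only [E8fun, E10fun, E14fun, f2fun, kleinJ, psi2, psi4, xi2, xi2S, xi4, xi4S, psiTilde0, psiTilde2,
      psiTilde4, Pi.mul_apply, Pi.add_apply, Pi.sub_apply, Pi.neg_apply, Pi.smul_apply, Pi.inv_apply,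
      smul_eq_mul, E₄_eq_theta, E₆_eq_theta, discriminant_eq_theta]
    field_simp
    simp only [thetaU_apply_eq]
    ring
  rwa [hnum, zero_div] at h

/-! ## Dimension `24` -/

/-- **Residue of `𝒦₊^{(24)}|₁₂γ` at `τ = z`** (`j′(z) ≠ 0`): the pole coefficients are
`(c𝔠E₁₄/Δ)(φ̃₂, −2φ̃₀, φ̃₋₂)` with `c𝔠 = π²/(36i)` — the same vector `resVecPlus8` as in dimension
`8` ("for both `d = 8` and `24`, `Res_{τ=z}Υ₊^{(d)} = (π/72)[[0,0,1],[0,−2,0],[1,0,0]]`").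
[cite: CohnEtAl2019, §4.4] -/
theorem hasKernelResidue_kernelPlus24_slash (z : ℍ) (γ : SL(2, ℤ))
    (hj : deriv (kleinJ ∘ ofComplex) z ≠ 0) :
    HasKernelResidue ((fun τ => kernelPlus24 τ z) ∣[(12 : ℤ)] γ) z
      (((phiNeg2 ∣[(-2 : ℤ)] γ) z * resVecPlus8 z 0 + (phi0 ∣[(0 : ℤ)] γ) z * resVecPlus8 z 1 +
        (phi2 ∣[(2 : ℤ)] γ) z * resVecPlus8 z 2) / deriv (kleinJ ∘ ofComplex) z) := by
  set c : ℂ := (π : ℂ) ^ 2 / (36 * 1728 * I) with hc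
  set a₁ : ℍ → ℂ := E14fun * fun τ => c / (ModularForm.discriminant z * (kleinJ τ - kleinJ z)) *
    (6 * (kleinJ τ - kleinJ z) * E₄ z * phiTildeNeg2 z + (1728 - 6 * (kleinJ τ - kleinJ z)) * phiTilde2 z) with ha₁
  set a₂ : ℍ → ℂ := ModularForm.discriminant * fun τ => c / (ModularForm.discriminant z * (kleinJ τ - kleinJ z)) *
    ((-12 * kleinJ τ + 5 * 1728) * (kleinJ τ - kleinJ z) * E₄ z * phiTildeNeg2 z -
      2 * 1728 * f2fun z * phiTilde0 z + (12 * kleinJ τ - 7 * 1728) * (kleinJ τ - kleinJ z) * phiTilde2 z) with ha₂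
  set a₃ : ℍ → ℂ := E10fun * fun τ => c / (ModularForm.discriminant z * (kleinJ τ - kleinJ z)) *
    ((1728 + 6 * (kleinJ τ - kleinJ z)) * E₄ z * phiTildeNeg2 z - 6 * (kleinJ τ - kleinJ z) * phiTilde2 z) with ha₃
  have h₁ : IsLevelOneInvariant (12 + 2) a₁ :=
    (isLevelOneInvariant_E14.mul (isLevelOneInvariant_comp_kleinJ fun j =>
      c / (ModularForm.discriminant z * (j - kleinJ z)) *
        (6 * (j - kleinJ z) * E₄ z * phiTildeNeg2 z + (1728 - 6 * (j - kleinJ z)) * phiTilde2 z))).cast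
      (by norm_num)
  have h₂ : IsLevelOneInvariant 12 a₂ :=
    (isLevelOneInvariant_discriminant.mul (isLevelOneInvariant_comp_kleinJ fun j =>
      c / (ModularForm.discriminant z * (j - kleinJ z)) *
        ((-12 * j + 5 * 1728) * (j - kleinJ z) * E₄ z * phiTildeNeg2 z -
          2 * 1728 * f2fun z * phiTilde0 z + (12 * j - 7 * 1728) * (j - kleinJ z) * phiTilde2 z))).cast
      (by norm_num)
  have h₃ : IsLevelOneInvariant (12 - 2) a₃ :=
    (isLevelOneInvariant_E10.mul (isLevelOneInvariant_comp_kleinJ fun j =>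
      c / (ModularForm.discriminant z * (j - kleinJ z)) *
        ((1728 + 6 * (j - kleinJ z)) * E₄ z * phiTildeNeg2 z - 6 * (j - kleinJ z) * phiTilde2 z))).cast
      (by norm_num)
  have key : (fun τ => kernelPlus24 τ z) = phiNeg2 * a₁ + phi0 * a₂ + phi2 * a₃ := by
    funext τ
    simp only [kernelPlus24, ha₁, ha₂, ha₃, hc, Pi.add_apply, Pi.mul_apply]
    ring
  have hslash : (fun τ => kernelPlus24 τ z) ∣[(12 : ℤ)] γ =
      phiNeg2 ∣[(-2 : ℤ)] γ * a₁ + phi0 ∣[(0 : ℤ)] γ * a₂ + phi2 ∣[(2 : ℤ)] γ * a₃ := by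
    rw [key, SlashAction.add_slash, SlashAction.add_slash, show (12 : ℤ) = -2 + (12 + 2) by norm_num,
      mul_slash_SL2, h₁ γ, show (-2 : ℤ) + (12 + 2) = 0 + 12 by norm_num, mul_slash_SL2, h₂ γ,
      show (0 : ℤ) + 12 = 2 + (12 - 2) by norm_num, mul_slash_SL2, h₃ γ]
  set A : ℍ → ℂ := fun τ => (phiNeg2 ∣[(-2 : ℤ)] γ) τ * (c / ModularForm.discriminant z * (E14fun τ * (1728 * phiTilde2 z))) +
    (phi0 ∣[(0 : ℤ)] γ) τ * (c / ModularForm.discriminant z * (ModularForm.discriminant τ * (-(2 * 1728 * f2fun z * phiTilde0 z)))) +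
    (phi2 ∣[(2 : ℤ)] γ) τ * (c / ModularForm.discriminant z * (E10fun τ * (1728 * E₄ z * phiTildeNeg2 z)))
    with hA
  set B : ℍ → ℂ := fun τ => (phiNeg2 ∣[(-2 : ℤ)] γ) τ * (c / ModularForm.discriminant z * (E14fun τ *
      (6 * E₄ z * phiTildeNeg2 z - 6 * phiTilde2 z))) +
    (phi0 ∣[(0 : ℤ)] γ) τ * (c / ModularForm.discriminant z * (ModularForm.discriminant τ *
      ((-12 * kleinJ τ + 5 * 1728) * E₄ z * phiTildeNeg2 z + (12 * kleinJ τ - 7 * 1728) * phiTilde2 z))) +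
    (phi2 ∣[(2 : ℤ)] γ) τ * (c / ModularForm.discriminant z * (E10fun τ * (6 * E₄ z * phiTildeNeg2 z - 6 * phiTilde2 z)))
    with hB
  have hcontφ : Continuous (phiNeg2 ∣[(-2 : ℤ)] γ) ∧ Continuous (phi0 ∣[(0 : ℤ)] γ) ∧
      Continuous (phi2 ∣[(2 : ℤ)] γ) :=
    ⟨continuous_sl_slash continuous_phiNeg2 _ _, continuous_sl_slash continuous_phi0 _ _,
      continuous_sl_slash continuous_phi2 _ _⟩
  have hE4 : Continuous (⇑E₄ : ℍ → ℂ) := E₄.holo'.continuous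
  have hE6 : Continuous (⇑E₆ : ℍ → ℂ) := E₆.holo'.continuous
  have hΔc : Continuous (ModularForm.discriminant : ℍ → ℂ) := CuspForm.discriminant.holo'.continuous
  have hE14 : Continuous E14fun := (hE4.mul hE4).mul hE6
  have hE10 : Continuous E10fun := hE4.mul hE6
  have hAc : Continuous A := by
    rw [hA]
    exact ((hcontφ.1.mul (continuous_const.mul (hE14.mul continuous_const))).add
      (hcontφ.2.1.mul (continuous_const.mul (hΔc.mul continuous_const)))).add
      (hcontφ.2.2.mul (continuous_const.mul (hE10.mul continuous_const)))
  have hBc : Continuous B := by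
    rw [hB]
    refine ((hcontφ.1.mul (continuous_const.mul (hE14.mul continuous_const))).add
      (hcontφ.2.1.mul (continuous_const.mul (hΔc.mul ?_)))).add
      (hcontφ.2.2.mul (continuous_const.mul (hE10.mul continuous_const)))
    exact ((((continuous_const.mul continuous_kleinJ).add continuous_const).mul continuous_const).mul
      continuous_const).add (((continuous_const.mul continuous_kleinJ).sub continuous_const).mul continuous_const)
  have hres := hasKernelResidue_div_kleinJ_sub hAc.continuousAt hBc.continuousAt hj
  have hval : A z / deriv (kleinJ ∘ ofComplex) z =
      ((phiNeg2 ∣[(-2 : ℤ)] γ) z * resVecPlus8 z 0 + (phi0 ∣[(0 : ℤ)] γ) z * resVecPlus8 z 1 +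
        (phi2 ∣[(2 : ℤ)] γ) z * resVecPlus8 z 2) / deriv (kleinJ ∘ ofComplex) z := by
    congr 1
    have hΔ := ModularForm.discriminant_ne_zero z
    simp only [hA, resVecPlus8, Matrix.cons_val_zero, Matrix.cons_val_one, Matrix.head_cons,
      Matrix.cons_val_two, Matrix.tail_cons, f2fun, E14fun, E10fun, E8fun, Pi.mul_apply, Pi.inv_apply, hc]
    field_simp
  rw [← hval]
  refine hres.congr' ?_
  filter_upwards [eventually_kleinJ_sub_ne_zero hj] with w hw
  have hw' := congrFun hslash (ofComplex w)
  simp only [Pi.add_apply, Pi.mul_apply] at hw'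
  rw [hw']
  have hΔ := ModularForm.discriminant_ne_zero z
  simp only [ha₁, ha₂, ha₃, hA, hB, Pi.mul_apply]
  field_simp
  ring

/-- **Theorem 4.1 (3) for `𝒦₊^{(24)}`**: the residues at `τ = z` of `𝒦₊^{(24)}`, `𝒦₊^{(24)}|₁₂T`,
`𝒦₊^{(24)}|₁₂TS` are `0`, `−1/(2π)`, `0` (`j′(z) ≠ 0`). [cite: CohnEtAl2019, Theorem 4.1 (3)] -/
theorem hasKernelResidue_kernelPlus24 (z : ℍ) (hj : deriv (kleinJ ∘ ofComplex) z ≠ 0) :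
    HasKernelResidue (fun τ => kernelPlus24 τ z) z 0 ∧
    HasKernelResidue ((fun τ => kernelPlus24 τ z) ∣[(12 : ℤ)] ModularGroup.T) z (-1 / (2 * π)) ∧
    HasKernelResidue ((fun τ => kernelPlus24 τ z) ∣[(12 : ℤ)] (ModularGroup.T * ModularGroup.S)) z 0 := by
  refine ⟨?_, ?_, ?_⟩
  · have h := hasKernelResidue_kernelPlus24_slash z 1 hj
    have h8 := hasKernelResidue_kernelPlus8 z hj
    have h8' := hasKernelResidue_kernelPlus8_slash z 1 hj
    rw [SlashAction.slash_one, SlashAction.slash_one, SlashAction.slash_one, SlashAction.slash_one] at h h8'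
    -- the value is the same as in dimension 8, which is `0`
    have := tendsto_nhds_unique h8' h8
    rwa [this] at h
  · have h := hasKernelResidue_kernelPlus24_slash z ModularGroup.T hj
    have h8 := hasKernelResidue_kernelPlus8_slash_T z hj
    have h8' := hasKernelResidue_kernelPlus8_slash z ModularGroup.T hj
    have := tendsto_nhds_unique h8' h8
    rwa [this] at h
  · have h := hasKernelResidue_kernelPlus24_slash z (ModularGroup.T * ModularGroup.S) hj
    have h8 := hasKernelResidue_kernelPlus8_slash_TS z hj
    have h8' := hasKernelResidue_kernelPlus8_slash z (ModularGroup.T * ModularGroup.S) hj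
    have := tendsto_nhds_unique h8' h8
    rwa [this] at h

/-- **Residue of `𝒦₋^{(24)}|₁₂γ` at `τ = z`** (`j′(z) ≠ 0`): the same value as for `𝒦₋^{(8)}|₄γ`
("for both `d = 8` and `24`", CKMRV §4.4), since `E₄E₁₀ = Δf₂`, `E₁₀(jψ̃₂ − f₋₂ψ̃₄) = f₂(E₈ψ̃₂ − E₆ψ̃₄)`,
`E₈((𝔠 − j)ψ̃₂ + f₋₂ψ̃₄) = (𝔠 − j)E₈ψ̃₂ + jE₆ψ̃₄`. [cite: CohnEtAl2019, §4.4] -/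
theorem hasKernelResidue_kernelMinus24_slash (z : ℍ) (γ : SL(2, ℤ))
    (hj : deriv (kleinJ ∘ ofComplex) z ≠ 0) :
    HasKernelResidue ((fun τ => kernelMinus24 τ z) ∣[(12 : ℤ)] γ) z
      ((1 / (2 * 1728 * (π : ℂ)) / ModularForm.discriminant z *
        (E₄ z * (-2 * 1728 * E10fun z * psiTilde0 z) +
          (psi2 ∣[(2 : ℤ)] γ) z * (f2fun z * (E8fun z * psiTilde2 z - E₆ z * psiTilde4 z)) +
          (psi4 ∣[(4 : ℤ)] γ) z * ((1728 - kleinJ z) * E8fun z * psiTilde2 z + kleinJ z * E₆ z * psiTilde4 z))) /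
        deriv (kleinJ ∘ ofComplex) z) := by
  set c : ℂ := 1 / (2 * 1728 * (π : ℂ)) with hc
  set a₁ : ℍ → ℂ := ModularForm.discriminant * fun τ =>
    c / (ModularForm.discriminant z * (kleinJ τ - kleinJ z)) *
      (-2 * 1728 * f2fun z * psiTilde0 z - 2 * 1728 * (kleinJ τ - kleinJ z) * psiTilde2 z) with ha₁
  set a₂ : ℍ → ℂ := E10fun * fun τ => c / (ModularForm.discriminant z * (kleinJ τ - kleinJ z)) *
    ((kleinJ τ + 2 * (kleinJ τ - kleinJ z)) * psiTilde2 z - fNeg2fun z * psiTilde4 z) with ha₂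
  set a₃ : ℍ → ℂ := E8fun * fun τ => c / (ModularForm.discriminant z * (kleinJ τ - kleinJ z)) *
    ((1728 - 2 * (kleinJ τ - kleinJ z) - kleinJ τ) * psiTilde2 z + fNeg2fun z * psiTilde4 z) with ha₃
  have h₁ : IsLevelOneInvariant 12 a₁ :=
    (isLevelOneInvariant_discriminant.mul (isLevelOneInvariant_comp_kleinJ fun j =>
      c / (ModularForm.discriminant z * (j - kleinJ z)) *
        (-2 * 1728 * f2fun z * psiTilde0 z - 2 * 1728 * (j - kleinJ z) * psiTilde2 z))).cast (by norm_num)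
  have h₂ : IsLevelOneInvariant (12 - 2) a₂ :=
    (isLevelOneInvariant_E10.mul (isLevelOneInvariant_comp_kleinJ fun j =>
      c / (ModularForm.discriminant z * (j - kleinJ z)) *
        ((j + 2 * (j - kleinJ z)) * psiTilde2 z - fNeg2fun z * psiTilde4 z))).cast (by norm_num)
  have h₃ : IsLevelOneInvariant (12 - 4) a₃ :=
    (isLevelOneInvariant_E8.mul (isLevelOneInvariant_comp_kleinJ fun j =>
      c / (ModularForm.discriminant z * (j - kleinJ z)) *
        ((1728 - 2 * (j - kleinJ z) - j) * psiTilde2 z + fNeg2fun z * psiTilde4 z))).cast (by norm_num)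
  have key : (fun τ => kernelMinus24 τ z) = a₁ + psi2 * a₂ + psi4 * a₃ := by
    funext τ
    simp only [kernelMinus24, ha₁, ha₂, ha₃, hc, Pi.add_apply, Pi.mul_apply]
    ring
  have hslash : (fun τ => kernelMinus24 τ z) ∣[(12 : ℤ)] γ = a₁ + psi2 ∣[(2 : ℤ)] γ * a₂ + psi4 ∣[(4 : ℤ)] γ * a₃ := by
    rw [key, SlashAction.add_slash, SlashAction.add_slash, h₁ γ, show (12 : ℤ) = 2 + (12 - 2) by norm_num,
      mul_slash_SL2, h₂ γ, show (2 : ℤ) + (12 - 2) = 4 + (12 - 4) by norm_num, mul_slash_SL2, h₃ γ]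
  set A : ℍ → ℂ := fun τ => c / ModularForm.discriminant z *
    (ModularForm.discriminant τ * (-2 * 1728 * f2fun z * psiTilde0 z) +
      (psi2 ∣[(2 : ℤ)] γ) τ * (E10fun τ * (kleinJ τ * psiTilde2 z - fNeg2fun z * psiTilde4 z)) +
      (psi4 ∣[(4 : ℤ)] γ) τ * (E8fun τ * ((1728 - kleinJ τ) * psiTilde2 z + fNeg2fun z * psiTilde4 z)))
    with hA
  set B : ℍ → ℂ := fun τ => c / ModularForm.discriminant z *
    (ModularForm.discriminant τ * (-2 * 1728 * psiTilde2 z) + (psi2 ∣[(2 : ℤ)] γ) τ * (E10fun τ * (2 * psiTilde2 z)) +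
      (psi4 ∣[(4 : ℤ)] γ) τ * (E8fun τ * (-2 * psiTilde2 z))) with hB
  have hE4 : Continuous (⇑E₄ : ℍ → ℂ) := E₄.holo'.continuous
  have hE6 : Continuous (⇑E₆ : ℍ → ℂ) := E₆.holo'.continuous
  have hΔc : Continuous (ModularForm.discriminant : ℍ → ℂ) := CuspForm.discriminant.holo'.continuous
  have hE10 : Continuous E10fun := hE4.mul hE6
  have hE8 : Continuous E8fun := hE4.mul hE4
  have hψ2 : Continuous (psi2 ∣[(2 : ℤ)] γ) := continuous_sl_slash continuous_psi2 _ _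
  have hψ4 : Continuous (psi4 ∣[(4 : ℤ)] γ) := continuous_sl_slash continuous_psi4 _ _
  have hAc : Continuous A := by
    rw [hA]
    refine continuous_const.mul (((hΔc.mul continuous_const).add (hψ2.mul (hE10.mul ((continuous_kleinJ.mul
      continuous_const).sub continuous_const)))).add (hψ4.mul (hE8.mul (((continuous_const.sub
      continuous_kleinJ).mul continuous_const).add continuous_const))))
  have hBc : Continuous B := by
    rw [hB]
    exact continuous_const.mul (((hΔc.mul continuous_const).add (hψ2.mul (hE10.mul continuous_const))).add
      (hψ4.mul (hE8.mul continuous_const)))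
  have hres := hasKernelResidue_div_kleinJ_sub hAc.continuousAt hBc.continuousAt hj
  have hval : A z / deriv (kleinJ ∘ ofComplex) z = (1 / (2 * 1728 * (π : ℂ)) / ModularForm.discriminant z *
      (E₄ z * (-2 * 1728 * E10fun z * psiTilde0 z) +
        (psi2 ∣[(2 : ℤ)] γ) z * (f2fun z * (E8fun z * psiTilde2 z - E₆ z * psiTilde4 z)) +
        (psi4 ∣[(4 : ℤ)] γ) z * ((1728 - kleinJ z) * E8fun z * psiTilde2 z + kleinJ z * E₆ z * psiTilde4 z))) /
      deriv (kleinJ ∘ ofComplex) z := by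
    congr 1
    have hΔ := ModularForm.discriminant_ne_zero z
    simp only [hA, hc, f2fun, fNeg2fun, E14fun, E10fun, E8fun, kleinJ, Pi.mul_apply, Pi.inv_apply]
    field_simp
  rw [← hval]
  refine hres.congr' ?_
  filter_upwards [eventually_kleinJ_sub_ne_zero hj] with w hw
  have hw' := congrFun hslash (ofComplex w)
  simp only [Pi.add_apply, Pi.mul_apply] at hw'
  rw [hw']
  have hΔ := ModularForm.discriminant_ne_zero z
  simp only [ha₁, ha₂, ha₃, hA, hB, Pi.mul_apply]
  field_simp
  ring

/-- **Theorem 4.1 (3) for `𝒦₋^{(24)}`**: the residues at `τ = z` of `𝒦₋^{(24)}`, `𝒦₋^{(24)}|₁₂T`,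
`𝒦₋^{(24)}|₁₂TS` are `0`, `−1/(2π)`, `0` (`j′(z) ≠ 0`). [cite: CohnEtAl2019, Theorem 4.1 (3)] -/
theorem hasKernelResidue_kernelMinus24 (z : ℍ) (hj : deriv (kleinJ ∘ ofComplex) z ≠ 0) :
    HasKernelResidue (fun τ => kernelMinus24 τ z) z 0 ∧
    HasKernelResidue ((fun τ => kernelMinus24 τ z) ∣[(12 : ℤ)] ModularGroup.T) z (-1 / (2 * π)) ∧
    HasKernelResidue ((fun τ => kernelMinus24 τ z) ∣[(12 : ℤ)] (ModularGroup.T * ModularGroup.S)) z 0 := by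
  refine ⟨?_, ?_, ?_⟩
  · have h := hasKernelResidue_kernelMinus24_slash z 1 hj
    have h8 := hasKernelResidue_kernelMinus8 z hj
    have h8' := hasKernelResidue_kernelMinus8_slash z 1 hj
    rw [SlashAction.slash_one] at h h8'
    have := tendsto_nhds_unique h8' h8
    rwa [this] at h
  · have h := hasKernelResidue_kernelMinus24_slash z ModularGroup.T hj
    have h8 := hasKernelResidue_kernelMinus8_slash_T z hj
    have h8' := hasKernelResidue_kernelMinus8_slash z ModularGroup.T hj
    have := tendsto_nhds_unique h8' h8
    rwa [this] at h
  · have h := hasKernelResidue_kernelMinus24_slash z (ModularGroup.T * ModularGroup.S) hj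
    have h8 := hasKernelResidue_kernelMinus8_slash_TS z hj
    have h8' := hasKernelResidue_kernelMinus8_slash z (ModularGroup.T * ModularGroup.S) hj
    have := tendsto_nhds_unique h8' h8
    rwa [this] at h

end Literature.NumberTheory.ModularForms
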